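import Literature.NumberTheory.GaloisRepresentations.HeckeCharacterValueFieldProofs
import Literature.NumberTheory.GaloisRepresentations.WeakAbelianDirectSummand
import HarnessLib

/-!
# Line `Sketch` for the crux `ReciprocityUpToIrreducibility` (item stmt-Langlands-14328), wave N12-V:
# the `ℓ`-adic avatar of an algebraic Hecke character is `E`-rational (Weil 1956)

Support file (closes nothing; stub `stub_rankOne_isRationalOver_of_heckeAvatar` of the registered
skeleton of line `Sketch`, continuation lead c9).

Let `K` be a number field, `ℓ` a prime, `ι : ℚ̄_ℓ ≃ ℂ` a field isomorphism, `χ` an ALGEBRAIC Hecke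
character of `K` and `ρ : Γ_K → GL₁(ℚ̄_ℓ)` a rank-one `ℓ`-adic representation which is, at all but
finitely many finite places `v`, unramified with arithmetic-Frobenius polynomial
`X - ι⁻¹(χ(ϖ_v))⁻¹`.  Then `ρ` is `E`-rational in the sense of Böckle–Hui §2.1
(`FramedGaloisRep.IsRationalOver`) for a number field `E ⊆ ℂ` embedded into `ℚ̄_ℓ` by `ι⁻¹`.

Proof: by Weil's theorem (tree: `HeckeCharacter.IsAlgebraic.exists_intermediateField_eventually_valueAtUniformizer_mem`)
there is a number field `E ⊆ ℂ` (an `IntermediateField ℚ ℂ`, finite-dimensional over `ℚ`) with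
`χ(ϖ_v) ∈ E` for all but finitely many `v`; at every such `v` which is also good for `ρ`, the
polynomial `P = X - (χ(ϖ_v))⁻¹ ∈ E[X]` (a subfield is closed under inverses) maps under
`ι⁻¹ ∘ (E ↪ ℂ)` to `X - ι⁻¹(χ(ϖ_v))⁻¹`, the Frobenius polynomial of `ρ` at `v`.

References: A. Weil, *On a certain type of characters of the idèle-class group of an algebraic
number-field* (1956), §1 [Weil1956].  G. Böckle, C.-Y. Hui, *Weak abelian direct summands and
irreducibility of Galois representations*, Math. Ann. 393 (2025), §2.1 [BockleHui2025].
-/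

noncomputable section

set_option linter.dupNamespace false -- project-wide option (lakefile weak.linter.dupNamespace); `Summit.Langlands.Langlands` is the mandated namespace

open scoped NumberField Classical Polynomial
open Filter IsDedekindDomain Polynomial
open Literature.NumberTheory.GaloisRepresentations

namespace Summit.Langlands.Langlands.Theorems.ReciprocityUpToIrreducibility

/-- **The polynomial bookkeeping.**  For `x` in a subfield `E ⊆ ℂ` and a ring map `f : ℂ →+* A`,
the degree-one polynomial `X - x⁻¹ ∈ E[X]` maps under `f ∘ (E ↪ ℂ)` to `X - f(x⁻¹) ∈ A[X]`
(subfields are closed under inverses, `algebraMap E ℂ ⟨x, _⟩ = x`).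
[cite: BockleHui2025, §2.1] -/
theorem map_X_sub_C_inv_intermediateField {A : Type} [CommRing A] (f : ℂ →+* A)
    (E : IntermediateField ℚ ℂ) {x : ℂ} (hx : x ∈ E) :
    (X - C ((⟨x, hx⟩ : E)⁻¹)).map (f.comp (algebraMap E ℂ)) = X - C (f x⁻¹) := by
  rw [Polynomial.map_sub, Polynomial.map_X, Polynomial.map_C, RingHom.comp_apply, map_inv₀]
  rfl

/-- **Weil 1956: Hecke avatars are `E`-rational (explicit-binder form).**  If
`ρ : Γ_K → GL₁(ℚ̄_ℓ)` is, at almost all places, unramified with arithmetic-Frobenius polynomial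
`X - ι⁻¹(χ(ϖ_v))⁻¹` for an ALGEBRAIC Hecke character `χ`, then `ρ` is `E`-rational
(`FramedGaloisRep.IsRationalOver`) for a number field `E ⊆ ℂ` containing the values `χ(ϖ_v)` at
almost all `v` (`IsAlgebraic.exists_intermediateField_eventually_valueAtUniformizer_mem`), embedded
into `ℚ̄_ℓ` by `ι⁻¹`: `X - ι⁻¹(χ(ϖ_v))⁻¹ = (X - (χ(ϖ_v))⁻¹).map (ι⁻¹|_E)`.
[cite: Weil1956, §1] [cite: BockleHui2025, §2.1] -/
theorem rankOne_isRationalOver_of_heckeAvatar {K : Type} [Field K] [NumberField K] {ℓ : ℕ}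
    [Fact ℓ.Prime] (ι : PadicAlgCl ℓ ≃+* ℂ) (ρ : FramedGaloisRep K (PadicAlgCl ℓ) 1)
    {χ : HeckeCharacter K} (hχ : χ.IsAlgebraic)
    (h : ∀ᶠ v : HeightOneSpectrum (𝓞 K) in cofinite, ρ.IsUnramifiedAt v ∧
        ρ.HasFrobCharpolyAt v (X - C (ι.symm (χ.valueAtUniformizer v)⁻¹))) :
    ∃ E : IntermediateField ℚ ℂ, FiniteDimensional ℚ E ∧
      ρ.IsRationalOver ((ι.symm : ℂ ≃+* PadicAlgCl ℓ).toRingHom.comp (algebraMap E ℂ)) := by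
  obtain ⟨E, hfd, hval⟩ := hχ.exists_intermediateField_eventually_valueAtUniformizer_mem
  refine ⟨E, hfd, ?_⟩
  rw [FramedGaloisRep.isRationalOver_iff]
  filter_upwards [h, hval] with v hv hvE
  refine ⟨hv.1, X - C ((⟨χ.valueAtUniformizer v, hvE⟩ : E)⁻¹), ?_⟩
  rw [map_X_sub_C_inv_intermediateField]
  exact hv.2

/-- **stub N12-V (Weil 1956: Hecke avatars are `E`-rational).**  If `ρ : Γ_K → GL₁(ℚ̄_ℓ)` is, at
almost all places, unramified with arithmetic-Frobenius polynomial `X - ι⁻¹(χ(ϖ_v))⁻¹` for an ALGEBRAIC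
Hecke character `χ`, then `ρ` is `E`-rational (`FramedGaloisRep.IsRationalOver`) for the number field
`E ⊆ ℂ` generated by the values of `χ` (`IsAlgebraic.exists_intermediateField_eventually_valueAtUniformizer_mem`),
embedded into `ℚ̄_ℓ` by `ι⁻¹`: `X - ι⁻¹(χ(ϖ_v))⁻¹ = (X - (χ(ϖ_v))⁻¹).map (ι⁻¹|_E)`
(`rankOne_isRationalOver_of_heckeAvatar`, closed form with the registered binders).
[cite: Weil1956, §1] [cite: BockleHui2025, §2.1] -/
theorem stub_rankOne_isRationalOver_of_heckeAvatar :
    ∀ (K : Type) [Field K] [NumberField K] (ℓ : ℕ) [Fact ℓ.Prime] (ι : PadicAlgCl ℓ ≃+* ℂ)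
      (ρ : FramedGaloisRep K (PadicAlgCl ℓ) 1) (χ : HeckeCharacter K), χ.IsAlgebraic →
      (∀ᶠ v : HeightOneSpectrum (𝓞 K) in cofinite, ρ.IsUnramifiedAt v ∧
          ρ.HasFrobCharpolyAt v (X - C (ι.symm (χ.valueAtUniformizer v)⁻¹))) →
      ∃ E : IntermediateField ℚ ℂ, FiniteDimensional ℚ E ∧
        ρ.IsRationalOver ((ι.symm : ℂ ≃+* PadicAlgCl ℓ).toRingHom.comp (algebraMap E ℂ)) :=
  fun _ _ _ _ _ ι ρ _ hχ h => rankOne_isRationalOver_of_heckeAvatar ι ρ hχ h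

end Summit.Langlands.Langlands.Theorems.ReciprocityUpToIrreducibility

end
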